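import Literature.AnabelianGeometry.EtaleTheta.SettingModelKrullCusp
import Literature.AnabelianGeometry.EtaleTheta.SettingModelChiTate2
import Literature.AnabelianGeometry.EtaleTheta.Discharge.Sec1KerToZOfCompactNormalClosure
import HarnessLib

/-!
# The untwisted KRULL model `modelκ`: ell-kernel coordinates, the Tate-module clause TM₂ (`tate2`), R1 and R3
# (origin-profile part 1 — the clauses of `IsThm16Origin` that do not read the cusp)

Mochizuki, *The étale theta function …*, Publ. RIMS **45** (2009) [EtTh], §1 p. 12–13 [cite: MochizukiEtTh2009, §1 p.13]:
«`(Δ^tp_Y)^ell` [≅ `Ẑ(1)`]», «`G_{K_N}` acts trivially on `(Δ^tp_X)^ell/N·(Δ^tp_Y)^ell`», «`Π^tp_Y` …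
`Z` … the dual graph», «the quotients `Π^tp_X ↠ (Π^tp_X)^Θ ↠ (Π^tp_X)^ell`». Cell abc-iut, layer L2 (NV lane,
origin-profile lineage of abc-iut-w5-d051: `SettingModelChiOriginProfile` / `SettingModelChiTate2` /
`SettingModelTateOrigin` / `SettingModelTateCuspOriginProfile`), seat abc-iut-w5-d165 (gen 4), row
«ISTHM16ORIGIN@modelκ′» (STATUS 11:17Z), PART 1: abc-iut-L2-t10's untwisted Krull model
`ThetaSetting.modelκ p` (K2 `SettingModelKrullTheta`: `Π^tp_X := Γ ⋊_{θ∘1} G_{ℚ_p}`, i.e. abc-iut-L2-t1's χ-model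
with the cyclotomic character replaced by `1`; `K = ℚ_p`, `q_X = p²`). PROOF-ONLY TRANSCRIPT (χ ↦ κ) of the χ-model
files named above — nothing new mathematically, every step is the χ-proof with `θ_{χσ}` replaced by `θ_1 = id`:

* §1 `mem_ellKer_curveκ_iff` / `mem_thetaKer_curveκ_iff` (abc-iut-L2-d1's `SettingModelChiLevelKernels` at κ):
  `g ∈ Ker(Π^tp_X ↠ (Π^tp_X)^ell)` iff `g.right = 1` and all levels `ĥ_N(pr₁ g.left)` have `x = y = 0`;
* §2 the `(ê, ê_b)`-coordinates (abc-iut-w5-d051's `SettingModelChiTate2` §3 at κ): `inl_mem_ellKer_curveκ_iff`,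
  `toEll_modelκ_apply/_eq_iff`, `toEll_inl_mem_ellPowersY_two_κ` (SQUARE CRITERION);
* §3 **`modelκ_tate2`** — TM₂ HOLDS at `modelκ` with `y₁ = inl b`, `z = inl a`, `ζ = −1`, `r = p` (with the TRIVIAL
  action conjugation by `g` is conjugation inside `Γ`, invisible in `(Π^tp_X)^ell`), and
  `modelκ_gknIsKernelOfAction_two` (abc-iut-w5-d051's `gknIsKernelOfAction_of_tate`);
* §4 **`kerToZIsCompactlyGenerated_modelκ`** (R1: `Π^tp_Y = Ker pr₂ ⋊ G_{ℚ_p}` is generated by the two COMPACT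
  subgroups `inl(Ker pr₂)`, `inr(G_{ℚ_p})` — abc-iut-L6-d6's `kerToZIsCompactlyGenerated_of_le_normalClosure`) and
  R3 `isQuotientMap_toTheta_modelκ` / `isQuotientMap_thetaToEll_modelκ`.

PART 2 (`SettingModelKrullCuspThm16Origin`, after abc-iut-L2-t10's K3 cusped record `modelκ′`) adds the cusp clause,
R2 (port of this seat's `model₂c_gtpYNFromCusp`) and assembles `IsThm16Origin`. SEMI-SYNTHETIC model, consistency
evidence only (the Galois action on `Γ` is trivial: TM₂ holds because the level-`2` character and the Kummer class of
`q_X = p²` over `ℚ_p` are trivial, exactly as at abc-iut-L2-t1's discrete root model — abc-iut-w5-d051's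
`model_tate2`); nothing of [EtTh] asserted; no side taken on [IUTchIII] Cor. 3.12; typed ≠ proved. 0 definitions.
-/

noncomputable section

namespace Literature.AnabelianGeometry.EtaleTheta.SettingModel

open Literature.AnabelianGeometry.SemiGraphs Thm16Sub Function _root_.Topology
open scoped commutatorElement

variable (p : ℕ) [Fact p.Prime]

/-! ## §1. The theta-quotient kernels of `curveκ` on the levels -/

/-- `Δ_X = inl(F̂₂)` as the image of `⊤` (κ-model). [cite: MochizukiEtTh2009, §1 p.12] -/
theorem deltaHat_curveκ_eq_map_inl :
    (curveκ p).DeltaHat = (⊤ : Subgroup F₂hatT).map (SemidirectProduct.inl : F₂hatT →* PiHtκ p) := by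
  rw [deltaHatκ_eq, ← SemidirectProduct.range_inl_eq_ker_rightHom, MonoidHom.range_eq_map]

/-- Closures pass through the closed embedding `inl` (κ-model). [cite: MochizukiEtTh2009, §1 p.12] -/
theorem mem_topologicalClosure_map_inl_PiHtκ_iff (H : Subgroup F₂hatT) (y : PiHtκ p) :
    y ∈ (H.map (SemidirectProduct.inl : F₂hatT →* PiHtκ p)).topologicalClosure ↔
      y.left ∈ H.topologicalClosure ∧ y.right = 1 := by
  rw [← SetLike.mem_coe, Subgroup.topologicalClosure_coe, Subgroup.coe_map,
    (isClosedEmbedding_inlHatκ p).closure_image_eq, ← Subgroup.topologicalClosure_coe]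
  constructor
  · rintro ⟨x, hx, rfl⟩
    have hx' : x ∈ H.topologicalClosure := hx
    exact ⟨by rwa [SemidirectProduct.left_inl], by rw [SemidirectProduct.right_inl]⟩
  · rintro ⟨h1, h2⟩
    refine ⟨y.left, (h1 : y.left ∈ (H.topologicalClosure : Set F₂hatT)), ?_⟩
    rw [← SemidirectProduct.inl_left_mul_inr_right y, h2, map_one, mul_one]
    simp

/-- **`Ker(Π^tp_X ↠ (Π^tp_X)^ell)` at the κ-model**: `g.right = 1` and every level `ĥ_N(pr₁ g.left)` has
`x = y = 0`. [cite: MochizukiEtTh2009, §1 p.12] -/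
theorem mem_ellKer_curveκ_iff (g : PiTpκ p) :
    g ∈ CurveTheta.ellKer (curveκ p) ↔
      (∀ N : ℕ+, (hHat N (gfpFst g.left)).x = 0 ∧ (hHat N (gfpFst g.left)).y = 0) ∧ g.right = 1 := by
  change toHatκ p g ∈ (⁅(curveκ p).DeltaHat, (curveκ p).DeltaHat⁆).topologicalClosure ↔ _
  rw [deltaHat_curveκ_eq_map_inl, ← Subgroup.map_commutator, mem_topologicalClosure_map_inl_PiHtκ_iff, toHatκ_left,
    toHatκ_right, mem_closure_commutator₂_iff_forall_hHat]

/-- **`Ker(Π^tp_X ↠ (Π^tp_X)^Θ)` at the κ-model**: `g.right = 1` and every level is trivial.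
[cite: MochizukiEtTh2009, §1 p.12] -/
theorem mem_thetaKer_curveκ_iff (g : PiTpκ p) :
    g ∈ CurveTheta.thetaKer (curveκ p) ↔ (∀ N : ℕ+, hHat N (gfpFst g.left) = 1) ∧ g.right = 1 := by
  change toHatκ p g ∈ (⁅⁅(curveκ p).DeltaHat, (curveκ p).DeltaHat⁆, (curveκ p).DeltaHat⁆).topologicalClosure ↔ _
  rw [deltaHat_curveκ_eq_map_inl, ← Subgroup.map_commutator, ← Subgroup.map_commutator,
    mem_topologicalClosure_map_inl_PiHtκ_iff, toHatκ_left, toHatκ_right, mem_closure_commutator₃_iff_forall_hHat]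

/-- `g.right = 1` on the ell-kernel (κ-model). [cite: MochizukiEtTh2009, §1 p.12] -/
theorem right_eq_one_of_mem_ellKer_curveκ {g : PiTpκ p} (hg : g ∈ CurveTheta.ellKer (curveκ p)) : g.right = 1 :=
  ((mem_ellKer_curveκ_iff p g).mp hg).2

variable {p} in
/-- An element of `Γ ⋊_κ G_{ℚ_p}` with trivial Galois component is `inl` of its `Γ`-component.
[cite: MochizukiEtTh2009, §1 p.12] -/
theorem eq_inl_of_right_eq_one_κ {g : PiTpκ p} (hg : g.right = 1) : g = SemidirectProduct.inl g.left :=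
  SemidirectProduct.ext (by simp) (by simp [hg])

/-! ## §2. The ell-quotient of the κ-model in the coordinates `(ê, ê_b)` -/

/-- **`inl q ∈ Ker(Π^tp_X ↠ (Π^tp_X)^ell)` iff `ê(pr₁ q) = 1` and `ê_b(pr₁ q) = 1`** (κ-model).
[cite: MochizukiEtTh2009, §1 p.12] -/
theorem inl_mem_ellKer_curveκ_iff (q : Gfp) :
    (SemidirectProduct.inl q : PiTpκ p) ∈ CurveTheta.ellKer (curveκ p) ↔
      eHat (gfpFst q) = 1 ∧ eHatB (gfpFst q) = 1 := by
  rw [mem_ellKer_curveκ_iff, SemidirectProduct.left_inl, SemidirectProduct.right_inl]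
  constructor
  · rintro ⟨h, -⟩
    refine ⟨zh_eq_one_of_forall_level fun N => ?_, zh_eq_one_of_forall_level fun N => ?_⟩
    · rw [← modN_eq_level, ← hHat_x_eq_modN_eHat, (h N).1, ofAdd_zero]
    · rw [← modN_eq_level, ← hHat_y_eq_modN_eHatB, (h N).2, ofAdd_zero]
  · rintro ⟨hx, hy⟩
    refine ⟨fun N => ⟨?_, ?_⟩, rfl⟩
    · exact hHat_x_eq_zero_of_eHat_eq_one N hx
    · have h := hHat_y_eq_modN_eHatB N (gfpFst q)
      rw [hy, map_one] at h
      exact ofAdd_eq_one.mp h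

/-- The ell-quotient map of the κ-model is the quotient by `CurveTheta.ellKer (curveκ p)`.
[cite: MochizukiEtTh2009, §1 p.12] -/
theorem toEll_modelκ_apply (g : PiTpκ p) :
    toEll (ThetaSetting.modelκ p) g = QuotientGroup.mk' (CurveTheta.ellKer (curveκ p)) g := by
  change ((CurveTheta.thetaToEll (curveκ p)).comp (CurveTheta.toTheta (curveκ p))) g = _
  rw [CurveTheta.thetaToEll_comp]

/-- Equality in `(Π^tp_X)^ell` of the κ-model. [cite: MochizukiEtTh2009, §1 p.12] -/
theorem toEll_modelκ_eq_iff (g h : PiTpκ p) :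
    toEll (ThetaSetting.modelκ p) g = toEll (ThetaSetting.modelκ p) h ↔
      g⁻¹ * h ∈ CurveTheta.ellKer (curveκ p) := by
  rw [toEll_modelκ_apply, toEll_modelκ_apply, QuotientGroup.mk'_apply, QuotientGroup.mk'_apply,
    QuotientGroup.eq]

/-- `Π^tp_Y` of the κ-model: `g ∈ Π^tp_Y ↔ pr₂ g.left = 0`. [cite: MochizukiEtTh2009, §1 p.12] -/
theorem mem_GtpY_modelκ_iff (g : PiTpκ p) : g ∈ (ThetaSetting.modelκ p).GtpY ↔ gfpSnd g.left = 1 := by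
  change g ∈ ((krullTwistData p).toZ).ker ↔ _
  rw [MonoidHom.mem_ker, GfpTwistData.toZ_apply]

/-- `inl q ∈ Δ^tp_Y` iff `pr₂ q = 0` (κ-model). [cite: MochizukiEtTh2009, §1 p.12] -/
theorem inl_mem_dtpY_modelκ_iff (q : Gfp) :
    (SemidirectProduct.inl q : PiTpκ p) ∈ (ThetaSetting.modelκ p).DtpY ↔ gfpSnd q = 1 := by
  change (SemidirectProduct.inl q : PiTpκ p) ∈ ((krullTwistData p).toZ).ker ⊓ (curveκ p).DeltaTemp ↔ _
  rw [Subgroup.mem_inf, MonoidHom.mem_ker, GfpTwistData.toZ_apply, SemidirectProduct.left_inl,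
    mem_deltaTempκ_iff, SemidirectProduct.right_inl]
  exact ⟨fun h => h.1, fun h => ⟨h, rfl⟩⟩

/-- Elements of `Δ^tp_Y` of the κ-model: `right = 1`, `pr₂ left = 0`, `ê(pr₁ left) = 1`.
[cite: MochizukiEtTh2009, §1 p.12] -/
theorem right_eq_one_and_eHat_eq_one_of_mem_dtpY_κ {y : PiTpκ p} (hy : y ∈ (ThetaSetting.modelκ p).DtpY) :
    y.right = 1 ∧ gfpSnd y.left = 1 ∧ eHat (gfpFst y.left) = 1 := by
  obtain ⟨h1, h2⟩ := Subgroup.mem_inf.mp hy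
  have hr : y.right = 1 := (mem_deltaTempκ_iff p y).mp h2
  have hs : gfpSnd y.left = 1 := by
    change y ∈ ((krullTwistData p).toZ).ker at h1
    rwa [MonoidHom.mem_ker, GfpTwistData.toZ_apply] at h1
  exact ⟨hr, hs, eHat_gfpFst_eq_one hs⟩

/-- `inl(b^t) ∈ Δ^tp_Y` (κ-model). [cite: MochizukiEtTh2009, §1 p.12] -/
theorem inl_bPowGfp_mem_dtpY_κ (t : ZH) :
    (SemidirectProduct.inl (bPowGfp t) : PiTpκ p) ∈ (ThetaSetting.modelκ p).DtpY :=
  (inl_mem_dtpY_modelκ_iff p _).mpr (gfpSnd_bPowGfp t)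

/-- **SQUARE CRITERION** (κ-model): if `ê(pr₁ q) = 1` and `ê_b(pr₁ q)` dies in `ℤ/2`, then
`(inl q)^ell ∈ 2·(Δ^tp_Y)^ell`. [cite: MochizukiEtTh2009, §1 p.13] -/
theorem toEll_inl_mem_ellPowersY_two_κ {q : Gfp} (hx : eHat (gfpFst q) = 1)
    (hy : ZHatLevel.level 2 (eHatB (gfpFst q)) = 1) :
    toEll (ThetaSetting.modelκ p) (SemidirectProduct.inl q) ∈ ellPowersY (ThetaSetting.modelκ p) 2 := by
  obtain ⟨t, ht⟩ := (ZHatLevel.level_eq_one_iff_exists_pow 2 _).mp hy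
  have h2 : ((2 : ℕ+) : ℕ) = 2 := rfl
  rw [h2] at ht
  set w : PiTpκ p := SemidirectProduct.inl (bPowGfp t) with hw
  have hwY : w ∈ (ThetaSetting.modelκ p).DtpY := inl_bPowGfp_mem_dtpY_κ p t
  have heq : toEll (ThetaSetting.modelκ p) (SemidirectProduct.inl q) =
      toEll (ThetaSetting.modelκ p) w ^ 2 := by
    rw [← map_pow, eq_comm, toEll_modelκ_eq_iff, hw, ← map_pow, ← map_inv, ← map_mul, inl_mem_ellKer_curveκ_iff,
      map_mul, map_inv, map_pow, gfpFst_bPowGfp, map_mul, map_mul, map_inv, map_inv, map_pow, map_pow,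
      eHat_bPow, eHatB_bPow, hx, ht, one_pow, inv_one, one_mul, inv_mul_cancel]
    exact ⟨rfl, rfl⟩
  rw [heq]
  refine Subgroup.subset_closure ⟨toEll (ThetaSetting.modelκ p) w, ⟨w, hwY, rfl⟩, ?_⟩
  simp only [h2]

/-! ## §3. The clause TM₂ at the κ-model -/

/-- `Ẑ` is commutative. [folklore] -/
private theorem zh_mul_comm' (a b : ZH) : a * b = b * a := by
  apply Subtype.ext
  funext N
  change a.val N * b.val N = b.val N * a.val N
  have key : ∀ u v : Multiplicative ℤ ⧸ N.toSubgroup, u * v = v * u := fun u v => _root_.mul_comm u v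
  exact key (a.val N) (b.val N)

/-- In `Multiplicative (ℤ/2)` every square is trivial. [folklore] -/
private theorem mulZMod_two_sq' (u : Multiplicative (ZMod 2)) : u ^ 2 = 1 := by
  rw [← ofAdd_toAdd u, ← ofAdd_nsmul, nsmul_eq_mul]
  have : (2 : ZMod 2) = 0 := rfl
  rw [show ((2 : ℕ) : ZMod 2) = 0 from this, zero_mul, ofAdd_zero]

/-- In `Multiplicative (ℤ/2)` every even power is trivial. [folklore] -/
private theorem mulZMod_two_pow_even' (u : Multiplicative (ZMod 2)) {k : ℕ} (hk : Even k) : u ^ k = 1 := by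
  obtain ⟨j, rfl⟩ := hk
  rw [← two_mul, pow_mul, mulZMod_two_sq', one_pow]

/-- In `Multiplicative (ℤ/2)` every element is its own inverse. [folklore] -/
private theorem mulZMod_two_inv' (u : Multiplicative (ZMod 2)) : u⁻¹ = u :=
  inv_eq_of_mul_eq_one_left (by rw [← sq, mulZMod_two_sq'])

/-- The graph element `(η a, 1) ∈ Γ` (a lift of `1 ∈ Z`). [cite: MochizukiEtTh2009, §1 p.12] -/
private theorem eta_a_mem_Gfp_κ :
    ((eta (FreeGroup.of 0), Multiplicative.ofAdd (1 : ℤ)) : F₂hatT × Multiplicative ℤ) ∈ Gfp := by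
  have h := eta_mk_mem_Gfp (FreeGroup.of 0)
  rwa [expA_apply, heisHom_of_zero] at h

/-- `−1 ≠ 1` in `ℚ̄_p`. [folklore] -/
private theorem neg_one_ne_one_κ : (-1 : PadicAlgCl p) ≠ 1 := by
  intro h
  have h2 : (2 : PadicAlgCl p) = 0 := by
    calc (2 : PadicAlgCl p) = 1 - (-1) := by norm_num
      _ = 0 := by rw [h, sub_self]
  exact two_ne_zero h2

/-- `(−1)^k = −1` forces `k` odd. [folklore] -/
private theorem odd_of_neg_one_pow_eq_κ {k : ℕ} (h : (-1 : PadicAlgCl p) ^ k = -1) : Odd k := by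
  rcases Nat.even_or_odd k with hk | hk
  · rw [hk.neg_one_pow] at h
    exact absurd h.symm (neg_one_ne_one_κ p)
  · exact hk

/-- `(−1)^m = 1` forces `m` even. [folklore] -/
private theorem even_of_neg_one_pow_eq_one_κ {m : ℕ} (h : (-1 : PadicAlgCl p) ^ m = 1) : Even m := by
  rcases Nat.even_or_odd m with hm | hm
  · exact hm
  · rw [hm.neg_one_pow] at h
    exact absurd h (neg_one_ne_one_κ p)

/-- Conjugation in `Π^tp_X = Γ ⋊_κ G_{ℚ_p}` of a `Δ`-element is conjugation INSIDE `Γ` (the action is trivial):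
`g · inl q · g⁻¹ = inl (g.left · q · g.left⁻¹)`. [cite: MochizukiEtTh2009, §1 p.12] -/
theorem conj_inl_eq_κ (g : PiTpκ p) (q : Gfp) :
    g * SemidirectProduct.inl q * g⁻¹ = SemidirectProduct.inl (g.left * q * g.left⁻¹) := by
  have h1 : (SemidirectProduct.inr g.right : PiTpκ p) * SemidirectProduct.inl q * (SemidirectProduct.inr g.right)⁻¹ =
      SemidirectProduct.inl (actκ p g.right q) := by
    rw [← map_inv, ← SemidirectProduct.inl_aut]
  calc g * SemidirectProduct.inl q * g⁻¹
      = (SemidirectProduct.inl g.left * SemidirectProduct.inr g.right) * SemidirectProduct.inl q *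
          (SemidirectProduct.inl g.left * SemidirectProduct.inr g.right)⁻¹ := by
        rw [SemidirectProduct.inl_left_mul_inr_right]
    _ = SemidirectProduct.inl g.left *
          ((SemidirectProduct.inr g.right : PiTpκ p) * SemidirectProduct.inl q * (SemidirectProduct.inr g.right)⁻¹) *
          (SemidirectProduct.inl g.left)⁻¹ := by group
    _ = SemidirectProduct.inl (g.left * q * g.left⁻¹) := by
        rw [h1, actκ_apply_eq, ← map_inv, ← map_mul, ← map_mul]

/-- **The clause TM₂ (`tate2`) HOLDS at the untwisted Krull model** with `y₁ = inl(b)`, `z = inl(a)`, `ζ = −1`,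
`r = p`: (a) `(Δ^tp_Y)^ell/2` is cyclic on `ȳ₁`; (a′) `ȳ₁^k` is a square iff `2 ∣ k`; (b) every `σ` acts trivially on
`Γ`, so `g y g⁻¹ ≡ y` up to a `Γ`-commutator (invisible in the ell-quotient) and `k` is odd; (c) `σ(p) = p` forces
`m` even and `[g, z]` is a `Γ`-commutator. [cite: MochizukiEtTh2009, §1 p.13] -/
theorem modelκ_tate2 :
    ∃ (y₁ z : (ThetaSetting.modelκ p).PiTemp) (ζ r : PadicAlgCl p),
      y₁ ∈ (ThetaSetting.modelκ p).DtpY ∧ z ∈ (ThetaSetting.modelκ p).DeltaTemp ∧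
      (ThetaSetting.modelκ p).toZ z = Multiplicative.ofAdd 1 ∧
      IsPrimitiveRoot ζ ((2 : ℕ+) : ℕ) ∧ r ^ ((2 : ℕ+) : ℕ) = (ThetaSetting.modelκ p).qX ∧
      (∀ y : (ThetaSetting.modelκ p).PiTemp, y ∈ (ThetaSetting.modelκ p).DtpY → ∃ k : ℕ,
        toEll (ThetaSetting.modelκ p) y * (toEll (ThetaSetting.modelκ p) y₁ ^ k)⁻¹ ∈
          ellPowersY (ThetaSetting.modelκ p) 2) ∧
      (∀ k : ℕ, toEll (ThetaSetting.modelκ p) y₁ ^ k ∈ ellPowersY (ThetaSetting.modelκ p) 2 ↔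
        ((2 : ℕ+) : ℕ) ∣ k) ∧
      (∀ (g : (ThetaSetting.modelκ p).PiTemp) (k : ℕ), (ThetaSetting.modelκ p).aug g ζ = ζ ^ k →
        ∀ y : (ThetaSetting.modelκ p).PiTemp, y ∈ (ThetaSetting.modelκ p).DtpY →
          toEll (ThetaSetting.modelκ p) (g * y * g⁻¹) * (toEll (ThetaSetting.modelκ p) y ^ k)⁻¹ ∈
            ellPowersY (ThetaSetting.modelκ p) 2) ∧
      (∀ (g : (ThetaSetting.modelκ p).PiTemp) (m : ℕ), (ThetaSetting.modelκ p).aug g r = ζ ^ m * r →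
        toEll (ThetaSetting.modelκ p) (g * z * g⁻¹ * z⁻¹) * (toEll (ThetaSetting.modelκ p) y₁ ^ m)⁻¹ ∈
          ellPowersY (ThetaSetting.modelκ p) 2) := by
  set D := ThetaSetting.modelκ p with hD
  have h2 : ((2 : ℕ+) : ℕ) = 2 := rfl
  have hp0 : ((p : ℕ) : PadicAlgCl p) ≠ 0 := Nat.cast_ne_zero.mpr (Fact.out : p.Prime).ne_zero
  -- the data
  let bG : Gfp := bPowGfp (iotaZ (Multiplicative.ofAdd 1))
  let aG : Gfp := ⟨(eta (FreeGroup.of 0), Multiplicative.ofAdd (1 : ℤ)), eta_a_mem_Gfp_κ⟩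
  let y₁ : D.PiTemp := (SemidirectProduct.inl bG : PiTpκ p)
  let z : D.PiTemp := (SemidirectProduct.inl aG : PiTpκ p)
  have hbG_x : eHat (gfpFst bG) = 1 := by rw [gfpFst_bPowGfp, eHat_bPow]
  have hbG_y : eHatB (gfpFst bG) = iotaZ (Multiplicative.ofAdd 1) := by rw [gfpFst_bPowGfp, eHatB_bPow]
  have haG_x : eHat (gfpFst aG) = iotaZ (Multiplicative.ofAdd 1) := by
    rw [gfpFst_apply]
    change eHat (eta (FreeGroup.of 0)) = _
    rw [eHat_eta, expA_apply, heisHom_of_zero]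
  have haG_y : eHatB (gfpFst aG) = 1 := by
    rw [gfpFst_apply]
    exact eHatB_eta_of_zero
  have hy₁ : y₁ ∈ D.DtpY := inl_bPowGfp_mem_dtpY_κ p _
  have hz : z ∈ D.DeltaTemp := (mem_deltaTempκ_iff p _).mpr (SemidirectProduct.right_inl _)
  have hzZ : D.toZ z = Multiplicative.ofAdd 1 := by
    change (krullTwistData p).toZ _ = _
    rw [GfpTwistData.toZ_apply, SemidirectProduct.left_inl, gfpSnd_apply]
  -- the level-`2` character, read in `ℤ/2`
  let lev : ZH →* Multiplicative (ZMod 2) := ZHatLevel.level 2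
  have hlev_bG : lev (eHatB (gfpFst bG)) = Multiplicative.ofAdd 1 := by
    rw [hbG_y]; exact level_two_iotaZ_one
  refine ⟨y₁, z, -1, ((p : ℕ) : PadicAlgCl p), hy₁, hz, hzZ, ?_, ?_, ?_, ?_, ?_, ?_⟩
  · rw [h2]; exact IsPrimitiveRoot.neg_one 0 (by decide)
  · rw [h2]; rfl
  · -- (a) generation: `y ≡ y₁^{ê_b(y) mod 2}` modulo squares
    intro y hy
    obtain ⟨hyr, -, hyx⟩ := right_eq_one_and_eHat_eq_one_of_mem_dtpY_κ p hy
    set v : ZMod 2 := Multiplicative.toAdd (lev (eHatB (gfpFst y.left))) with hv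
    refine ⟨v.val, ?_⟩
    rw [← map_pow (toEll D), ← map_inv (toEll D), ← map_mul (toEll D), eq_inl_of_right_eq_one_κ hyr]
    change toEll D (SemidirectProduct.inl y.left * ((SemidirectProduct.inl bG : PiTpκ p) ^ v.val)⁻¹) ∈ _
    rw [← map_pow (SemidirectProduct.inl : Gfp →* PiTpκ p), ← map_inv (SemidirectProduct.inl : Gfp →* PiTpκ p),
      ← map_mul (SemidirectProduct.inl : Gfp →* PiTpκ p)]
    refine toEll_inl_mem_ellPowersY_two_κ p ?_ ?_
    · simp only [map_mul, map_inv, map_pow, hyx, hbG_x, one_pow, inv_one, mul_one]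
    · show lev (eHatB (gfpFst (y.left * (bG ^ v.val)⁻¹))) = 1
      simp only [map_mul, map_inv, map_pow]
      rw [hlev_bG, ← ofAdd_nsmul, nsmul_eq_mul, mul_one, ZMod.natCast_zmod_val, hv, ofAdd_toAdd,
        mul_inv_cancel]
  · -- (a′) `ȳ₁^k` is a square iff `2 ∣ k`
    intro k
    rw [h2]
    constructor
    · intro hk
      -- the level-2 `b`-exponent as a homomorphism on `Π^tp_X` (trivial action!), descended to `(Π^tp_X)^ell`
      let Ψ₀ : PiTpκ p →* Multiplicative (ZMod 2) :=
        MonoidHom.mk' (fun g => lev (eHatB (gfpFst g.left))) fun g h => by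
          show lev (eHatB (gfpFst (g * h).left)) = lev (eHatB (gfpFst g.left)) * lev (eHatB (gfpFst h.left))
          rw [SemidirectProduct.mul_left, actκ_apply_eq, map_mul, map_mul, map_mul]
      have hΨ₀ : ∀ g : PiTpκ p, Ψ₀ g = lev (eHatB (gfpFst g.left)) := fun _ => rfl
      have hker : CurveTheta.ellKer (curveκ p) ≤ Ψ₀.ker := by
        intro g hg
        have hgr : g.right = 1 := right_eq_one_of_mem_ellKer_curveκ p hg
        rw [eq_inl_of_right_eq_one_κ hgr, inl_mem_ellKer_curveκ_iff] at hg
        rw [MonoidHom.mem_ker, hΨ₀, hg.2, map_one]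
      let Ψ : D.GtpEll →* Multiplicative (ZMod 2) := QuotientGroup.lift (CurveTheta.ellKer (curveκ p)) Ψ₀ hker
      have hΨ : ∀ g : PiTpκ p, Ψ (toEll D g) = Ψ₀ g := fun g => by
        change Ψ (toEll (ThetaSetting.modelκ p) g) = _
        rw [toEll_modelκ_apply, QuotientGroup.mk'_apply]
        exact QuotientGroup.lift_mk _ hker g
      have hS : ellPowersY D 2 ≤ Ψ.ker := by
        rw [ellPowersY, Subgroup.closure_le]
        rintro _ ⟨e, ⟨w, -, rfl⟩, rfl⟩
        change toEll D w ^ ((2 : ℕ+) : ℕ) ∈ Ψ.ker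
        rw [MonoidHom.mem_ker, map_pow, h2, mulZMod_two_sq']
      have h1 : Ψ (toEll D y₁ ^ k) = 1 := (MonoidHom.mem_ker).mp (hS hk)
      rw [map_pow, hΨ, hΨ₀, SemidirectProduct.left_inl, hlev_bG] at h1
      have h1' := congrArg Multiplicative.toAdd h1
      rw [toAdd_pow, toAdd_ofAdd, toAdd_one, nsmul_eq_mul, mul_one] at h1'
      exact (ZMod.natCast_eq_zero_iff k 2).mp h1'
    · rintro ⟨j, rfl⟩
      rw [pow_mul', ← map_pow (toEll D)]
      exact Subgroup.subset_closure ⟨toEll D (y₁ ^ j), ⟨y₁ ^ j, D.DtpY.pow_mem hy₁ j, rfl⟩, rfl⟩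
  · -- (b) trivial twist: `k` is odd; conjugation is conjugation inside `Γ`, invisible mod `[Γ,Γ]` and squares
    intro g k hk y hy
    have hk' : (-1 : PadicAlgCl p) ^ k = -1 := by rw [← hk, map_neg, map_one]
    have hkodd := odd_of_neg_one_pow_eq_κ p hk'
    obtain ⟨hyr, -, hyx⟩ := right_eq_one_and_eHat_eq_one_of_mem_dtpY_κ p hy
    rw [← map_pow (toEll D), ← map_inv (toEll D), ← map_mul (toEll D), eq_inl_of_right_eq_one_κ hyr,
      conj_inl_eq_κ,
      ← map_pow (SemidirectProduct.inl : Gfp →* PiTpκ p), ← map_inv (SemidirectProduct.inl : Gfp →* PiTpκ p),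
      ← map_mul (SemidirectProduct.inl : Gfp →* PiTpκ p)]
    refine toEll_inl_mem_ellPowersY_two_κ p ?_ ?_
    · simp only [map_mul, map_inv, map_pow, hyx, one_pow, inv_one, mul_one, mul_inv_cancel]
    · show lev (eHatB (gfpFst (g.left * y.left * g.left⁻¹ * (y.left ^ k)⁻¹))) = 1
      simp only [map_mul, map_inv, map_pow]
      rw [mulZMod_two_inv', mulZMod_two_inv', mul_right_comm _ _ (lev (eHatB (gfpFst g.left))), ← sq,
        mulZMod_two_sq', one_mul, ← pow_succ']
      exact mulZMod_two_pow_even' _ (hkodd.add_odd odd_one)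
  · -- (c) Kummer class of `q_X = p²` over `ℚ_p`: `m` is even; `[g, z]` is a `Γ`-commutator
    intro g m hm
    have hm1 : (-1 : PadicAlgCl p) ^ m = 1 := by
      have h' : (-1 : PadicAlgCl p) ^ m * (p : ℕ) = 1 * (p : ℕ) := by
        rw [one_mul, ← hm]; exact map_natCast _ p
      exact mul_right_cancel₀ hp0 h'
    have hmev := even_of_neg_one_pow_eq_one_κ p hm1
    change toEll D (g * SemidirectProduct.inl aG * g⁻¹ * (SemidirectProduct.inl aG)⁻¹) *
        (toEll D (SemidirectProduct.inl bG) ^ m)⁻¹ ∈ _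
    rw [← map_pow (toEll D), ← map_inv (toEll D), ← map_mul (toEll D), conj_inl_eq_κ,
      ← map_inv (SemidirectProduct.inl : Gfp →* PiTpκ p), ← map_mul (SemidirectProduct.inl : Gfp →* PiTpκ p),
      ← map_pow (SemidirectProduct.inl : Gfp →* PiTpκ p), ← map_inv (SemidirectProduct.inl : Gfp →* PiTpκ p),
      ← map_mul (SemidirectProduct.inl : Gfp →* PiTpκ p)]
    refine toEll_inl_mem_ellPowersY_two_κ p ?_ ?_
    · simp only [map_mul, map_inv, map_pow, haG_x, hbG_x, one_pow, inv_one, mul_one]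
      rw [zh_mul_comm' (eHat (gfpFst g.left)) (iotaZ (Multiplicative.ofAdd 1))]
      group
    · show lev (eHatB (gfpFst (g.left * aG * g.left⁻¹ * aG⁻¹ * (bG ^ m)⁻¹))) = 1
      simp only [map_mul, map_inv, map_pow, haG_y, hlev_bG, inv_one, mul_one, mul_inv_cancel, one_mul]
      rw [inv_eq_one]
      exact mulZMod_two_pow_even' _ hmev

/-- **«`G_{K_2} = Ker(G_K ↷ (Δ^tp_X)^ell / 2·(Δ^tp_Y)^ell)`» HOLDS at the κ-model** (abc-iut-L6-d5's
`Thm16Sub.GKNIsKernelOfAction (modelκ p) 2`, by abc-iut-w5-d051's `gknIsKernelOfAction_of_tate`).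
[cite: MochizukiEtTh2009, §1 p.13] -/
theorem modelκ_gknIsKernelOfAction_two : GKNIsKernelOfAction (ThetaSetting.modelκ p) 2 := by
  obtain ⟨y₁, z, ζ, r, hy₁, hz, hzZ, hζ, hr, -, hord, htw, hkum⟩ := modelκ_tate2 p
  exact gknIsKernelOfAction_of_tate (ThetaSetting.modelκ p) 2 hy₁ hz hzZ hζ hr hord htw hkum

/-! ## §4. R1 and R3 at the κ-model -/

/-- **R1 HOLDS at the κ-model**: `Π^tp_Y = Ker pr₂ ⋊ G_{ℚ_p}` is topologically generated by the two COMPACT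
subgroups `inl(Ker pr₂)` and `inr(G_{ℚ_p})` (Krull-compact), and compact subgroups die in `Z`.
[cite: MochizukiEtTh2009, §1 p.12] -/
theorem kerToZIsCompactlyGenerated_modelκ : KerToZIsCompactlyGenerated (ThetaSetting.modelκ p) := by
  haveI := compactSpace_GQp p
  let K : Bool → Subgroup (PiTpκ p) := fun b =>
    if b then (gfpSnd.ker).map (SemidirectProduct.inl : Gfp →* PiTpκ p)
    else (⊤ : Subgroup (GQp p)).map (SemidirectProduct.inr : GQp p →* PiTpκ p)
  have hKt : K true = (gfpSnd.ker).map (SemidirectProduct.inl : Gfp →* PiTpκ p) := rfl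
  have hKf : K false = (⊤ : Subgroup (GQp p)).map (SemidirectProduct.inr : GQp p →* PiTpκ p) := rfl
  refine ThetaSetting.kerToZIsCompactlyGenerated_of_le_normalClosure (ThetaSetting.modelκ p) K ?_ ?_
  · intro b
    cases b
    · rw [hKf, Subgroup.coe_map, Subgroup.coe_top]
      exact isCompact_univ.image (continuous_inrκ p)
    · rw [hKt, Subgroup.coe_map]
      exact isCompact_ker_gfpSnd.image (continuous_inlκ p)
  · intro g hg
    rw [mem_GtpY_modelκ_iff] at hg
    refine Subgroup.le_topologicalClosure _ ?_
    rw [← SemidirectProduct.inl_left_mul_inr_right g]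
    refine Subgroup.mul_mem _ (Subgroup.subset_normalClosure ?_) (Subgroup.subset_normalClosure ?_)
    · exact Set.mem_iUnion.mpr ⟨true, by rw [hKt]; exact ⟨g.left, hg, rfl⟩⟩
    · exact Set.mem_iUnion.mpr ⟨false, by rw [hKf]; exact ⟨g.right, Subgroup.mem_top _, rfl⟩⟩

/-- **R3, first half, at the κ-model**: `Π^tp_X ↠ (Π^tp_X)^Θ` is a quotient map. [cite: MochizukiEtTh2009, §1 p.12] -/
theorem isQuotientMap_toTheta_modelκ : IsQuotientMap (ThetaSetting.modelκ p).toTheta :=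
  QuotientGroup.isQuotientMap_mk (CurveTheta.thetaKer (curveκ p))

/-- **R3, second half, at the κ-model**: `(Π^tp_X)^Θ ↠ (Π^tp_X)^ell` is a quotient map. [cite: MochizukiEtTh2009, §1 p.12] -/
theorem isQuotientMap_thetaToEll_modelκ : IsQuotientMap (ThetaSetting.modelκ p).thetaToEll := by
  have hcomp : ((ThetaSetting.modelκ p).thetaToEll ∘ (ThetaSetting.modelκ p).toTheta :
      (ThetaSetting.modelκ p).PiTemp → (ThetaSetting.modelκ p).GtpEll) =
        (QuotientGroup.mk' (CurveTheta.ellKer (curveκ p)) : PiTpκ p → CurveTheta.GEll (curveκ p)) := by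
    have h := CurveTheta.thetaToEll_comp (curveκ p)
    exact congrArg (fun f : PiTpκ p →* CurveTheta.GEll (curveκ p) => (f : PiTpκ p → CurveTheta.GEll (curveκ p))) h
  have hq : IsQuotientMap ((ThetaSetting.modelκ p).thetaToEll ∘ (ThetaSetting.modelκ p).toTheta) := by
    rw [hcomp]
    exact QuotientGroup.isQuotientMap_mk (CurveTheta.ellKer (curveκ p))
  exact IsQuotientMap.of_comp (ThetaSetting.modelκ p).continuous_toTheta (ThetaSetting.modelκ p).continuous_thetaToEll hq

end Literature.AnabelianGeometry.EtaleTheta.SettingModel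

end
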